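import Summits.ResolutionOfSingularities.ResolutionOfSingularities.Theorems.EquisingularLiftEquisingularLiftNatSpecimenQuarticForms
import HarnessLib

/-!
# [OURS · L1 W4.5(b)] SPECIMEN-Q: the AMBIENT point-step charts at the vertex of `H = V(x₀²x₃² + x₁⁴ + x₂⁴)`

Helper for the n = 3 child crux `EquisingularLiftNatThree` (stmt-ResolutionOfSingularities-20148) of
`EquisingularLiftNat` (stmt-ResolutionOfSingularities-20038; route `EquisingularLift`, chain w45b): the
ring-level inputs (C1)–(C4) asked by res-D-pv-034 (SPECIMEN-Q DOWNSTAIRS, 2026-08-27T09:17:35Z) for the two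
(TC) clauses «`e ⊄ St H`» and «`Sing V(Z)_red` finite» of the registered stub
`stub_elnat_tcDeltaPointResolution`, which live in the AMBIENT blow-up of `ℙ³` at the vertex, not in `Bl H`.
NOT a statement of any manuscript; AI-written kernel lemmas of the cell `res-hironaka` (weaker than expert
review).

**Setting.** `A = k[X₀, X₁, X₂]` = the chart `x₃ = 1` of `ℙ³`, `fN := fSing′ = X₀² + X₁⁴ + X₂⁴`
(`…NatSpecimenQuarticForms`), `Cᵢ := PointBlowup.Chart 2 k i = A[𝔪/Xᵢ]` (`PointBlowupAlgebraCharts.lean`),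
`excᵢ = Xᵢ ∈ Cᵢ`, `fracᵢⱼ = Xⱼ/Xᵢ`. The strict transforms of the equation on the three charts are

* `st₀ = 1 + exc₀²(frac₀₁⁴ + frac₀₂⁴)`, `st₁ = frac₁₀² + exc₁²(1 + frac₁₂⁴)`, `st₂ = frac₂₀² + exc₂²(frac₂₁⁴ + 1)`

(spelled out literally in every statement; no definitions are introduced).

* (C1) `algebraMap_fSing'_chart₀/₁/₂` : `fN = excᵢ² · stᵢ` in `Cᵢ`;
* (C2) `prime_st₁`, `prime_st₂` (`k = k̄`, `char k ≠ 2`: under `k[T₀,T₁,T₂] ≅ Cᵢ` the polynomial is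
  `T₀² + T₁²(1 + T₂⁴)` resp. `T₀² + T₂²(T₁⁴ + 1)`, Eisenstein in `T₀` at the rational point `(T₁,T₂) = (1, ζ)` resp.
  `(ζ, 1)`, `ζ⁴ = −1`), `not_st_dvd_exc₁/₂` (a zero of `stᵢ` off `V(excᵢ)`), and `not_exc_dvd_st₀/₁/₂`
  (a zero of `excᵢ` off `V(stᵢ)`; no hypothesis on `k`);
* (C3) `radical_span_exc_st₁/₂` : `√(excᵢ, stᵢ) = (excᵢ, fracᵢ₀)`, `isPrime_span_exc_frac₁/₂`,
  `isRegularRing_quotient_span_exc_frac₁/₂` (`Cᵢ/(excᵢ, fracᵢ₀) ≅ k[one variable]`);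
* (C4) `span_exc_st₀_eq_top` : `(exc₀, st₀) = (1)`; `isPrime_span_exc_frac_frac₀` (the point
  `(exc₀, frac₀₁, frac₀₂)` of `e ∖ St H` exists);
* bonus, the strict transform at ring level: `ker_mapQuotient_fSing'_chart₀/₁/₂` — the kernel of
  `Cᵢ → (A/fN)[𝔪̄/X̄ᵢ]` (= the `excᵢ`-saturation of `fN · Cᵢ`, GW 13.96 (2)) is `(stᵢ)` on all three charts.

References: Stacks 0804, 0BIQ; Görtz–Wedhorn I, Prop. 13.96 (2); Eisenbud–Harris, *3264 and All That*, §9.3.2.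
-/

set_option linter.dupNamespace false -- mandated namespace `Summit.<Summit>.<Problem>` of this single-conjunct summit

noncomputable section

open MvPolynomial
open Literature.AlgebraicGeometry.Resolution Literature.AlgebraicGeometry.Motives.SmoothHypersurface

namespace Summit.ResolutionOfSingularities.ResolutionOfSingularities.Theorems.EquisingularLift.SpecimenQuartic

variable (k : Type) [Field k]

/-! ## Transport engine: images of coordinate ideals under `k[T₀,T₁,T₂] ≅ Cᵢ` -/
/-- If a ring isomorphism `θ : k[T₀,T₁,T₂] ≅ C` maps the set of variables `{T_j : j ∈ s}` onto `S`, then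
`(S)` is a prime ideal of `C` and `C/(S) ≅ k[T_j : j ∉ s]` is a regular ring. [folklore] -/
theorem isPrime_and_isRegularRing_of_image_X {C : Type} [CommRing C]
    (θ : MvPolynomial (Fin 3) k ≃+* C) (s : Set (Fin 3)) {S : Set C}
    (hS : θ '' ((X : Fin 3 → MvPolynomial (Fin 3) k) '' s) = S) :
    (Ideal.span S).IsPrime ∧ IsRegularRing (C ⧸ Ideal.span S) := by
  have hmap : Ideal.map θ (Ideal.span ((X : Fin 3 → MvPolynomial (Fin 3) k) '' s)) = Ideal.span S := by
    rw [Ideal.map_span, hS]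
  let e : (MvPolynomial (Fin 3) k ⧸ Ideal.span ((X : Fin 3 → MvPolynomial (Fin 3) k) '' s)) ≃+*
      C ⧸ Ideal.span S :=
    Ideal.quotientEquiv _ _ θ hmap.symm
  haveI := MvPolynomial.isDomain_quotient_span_X (R := k) s
  haveI : IsDomain (C ⧸ Ideal.span S) := e.symm.toMulEquiv.isDomain
  exact ⟨(Ideal.Quotient.isDomain_iff_prime _).mp inferInstance,
    IsRegularRing.of_ringEquiv ((MvPolynomial.quotientSpanXEquiv (R := k) s).toRingEquiv.symm.trans e)⟩

/-- If `p ∣ q` in `C` then, read back through `θ : k[T] ≅ C`, the values at any point divide: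
`(θ⁻¹ p)(a) ∣ (θ⁻¹ q)(a)`. [folklore] -/
theorem eval_symm_dvd_of_dvd {C : Type} [CommRing C] (θ : MvPolynomial (Fin 3) k ≃+* C) (a : Fin 3 → k)
    {p q : C} (h : p ∣ q) : eval a (θ.symm p) ∣ eval a (θ.symm q) :=
  map_dvd (eval a) (map_dvd θ.symm h)

/-! ## (C1) The factorisations `fN = excᵢ² · stᵢ` -/
/-- **(C1), chart `X₀ ≠ 0`:** `fN = exc₀² · (1 + exc₀²(frac₀₁⁴ + frac₀₂⁴))` in `C₀ = A[𝔪/X₀]`.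
[OURS · SPECIMEN-Q vertex charts; Stacks 0804] -/
theorem algebraMap_fSing'_chart₀ :
    algebraMap (MvPolynomial (Fin 3) k) (PointBlowup.Chart 2 k 0) (fSing' k) =
      PointBlowup.exc 2 k 0 ^ 2 *
        (1 + PointBlowup.exc 2 k 0 ^ 2 * (PointBlowup.frac 2 k 0 1 ^ 4 + PointBlowup.frac 2 k 0 2 ^ 4)) := by
  rw [fSing', map_add, map_add, map_pow, map_pow, map_pow, PointBlowup.algebraMap_X 2 k 0 0,
    PointBlowup.algebraMap_X 2 k 0 1, PointBlowup.algebraMap_X 2 k 0 2, PointBlowup.frac_self]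
  ring

/-- **(C1), chart `X₁ ≠ 0`:** `fN = exc₁² · (frac₁₀² + exc₁²(1 + frac₁₂⁴))` in `C₁ = A[𝔪/X₁]`.
[OURS · SPECIMEN-Q vertex charts; Stacks 0804] -/
theorem algebraMap_fSing'_chart₁ :
    algebraMap (MvPolynomial (Fin 3) k) (PointBlowup.Chart 2 k 1) (fSing' k) =
      PointBlowup.exc 2 k 1 ^ 2 *
        (PointBlowup.frac 2 k 1 0 ^ 2 + PointBlowup.exc 2 k 1 ^ 2 * (1 + PointBlowup.frac 2 k 1 2 ^ 4)) := by
  rw [fSing', map_add, map_add, map_pow, map_pow, map_pow, PointBlowup.algebraMap_X 2 k 1 0,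
    PointBlowup.algebraMap_X 2 k 1 1, PointBlowup.algebraMap_X 2 k 1 2, PointBlowup.frac_self]
  ring

/-- **(C1), chart `X₂ ≠ 0`:** `fN = exc₂² · (frac₂₀² + exc₂²(frac₂₁⁴ + 1))` in `C₂ = A[𝔪/X₂]`.
[OURS · SPECIMEN-Q vertex charts; Stacks 0804] -/
theorem algebraMap_fSing'_chart₂ :
    algebraMap (MvPolynomial (Fin 3) k) (PointBlowup.Chart 2 k 2) (fSing' k) =
      PointBlowup.exc 2 k 2 ^ 2 *
        (PointBlowup.frac 2 k 2 0 ^ 2 + PointBlowup.exc 2 k 2 ^ 2 * (PointBlowup.frac 2 k 2 1 ^ 4 + 1)) := by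
  rw [fSing', map_add, map_add, map_pow, map_pow, map_pow, PointBlowup.algebraMap_X 2 k 2 0,
    PointBlowup.algebraMap_X 2 k 2 1, PointBlowup.algebraMap_X 2 k 2 2, PointBlowup.frac_self]
  ring

/-! ## (C2) The strict transforms `st₁`, `st₂` are prime and do not divide the exceptional equation -/
/-- `T₀² + T₁²(1 + T₂⁴) ∈ k[T₀,T₁,T₂]` is prime for `k = k̄`, `char k ≠ 2`: as `Y² + C(T₁²(1 + T₂⁴))` it is
Eisenstein at the rational point `(T₁, T₂) = (1, ζ)`, `ζ⁴ = −1`, where `∂/∂T₂` of the constant term is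
`4ζ³ ≠ 0`. [folklore] -/
theorem prime_sq_add_sq_mul_one_add_pow_four [IsAlgClosed k] (h2 : (2 : k) ≠ 0) :
    Prime (X 0 ^ 2 + X 1 ^ 2 * (1 + X 2 ^ 4) : MvPolynomial (Fin 3) k) := by
  obtain ⟨ζ, hζ⟩ := IsAlgClosed.exists_pow_nat_eq (-1 : k) (by norm_num : 0 < 4)
  have hζ0 : ζ ≠ 0 := by rintro rfl; norm_num at hζ
  have hfin : finSuccEquiv k 2 (X 0 ^ 2 + X 1 ^ 2 * (1 + X 2 ^ 4)) =
      Polynomial.X ^ 2 + Polynomial.C (X 0 ^ 2 * (1 + X 1 ^ 4)) := by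
    have h1 : finSuccEquiv k 2 (X 1) = Polynomial.C (X 0) := finSuccEquiv_X_succ (j := 0)
    have h2' : finSuccEquiv k 2 (X 2) = Polynomial.C (X 1) := finSuccEquiv_X_succ (j := 1)
    simp only [map_add, map_mul, map_pow, map_one, finSuccEquiv_X_zero, h1, h2']
  have hirr : Irreducible (X 0 ^ 2 + X 1 ^ 2 * (1 + X 2 ^ 4) : MvPolynomial (Fin 3) k) := by
    rw [← MulEquiv.irreducible_iff (finSuccEquiv k 2), hfin]
    refine irreducible_X_pow_add_C (by norm_num) _ ![1, ζ] ?_ 1 ?_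
    · simp only [map_add, map_mul, map_pow, map_one, eval_X, Matrix.cons_val_zero, Matrix.cons_val_one, hζ, one_pow]
      ring
    · have hd : (pderiv 1 : Derivation k (MvPolynomial (Fin 2) k) _) (X 0 ^ 2 * (1 + X 1 ^ 4)) =
          X 0 ^ 2 * (4 * X 1 ^ 3) := by
        simp [Derivation.leibniz, Derivation.leibniz_pow]
      rw [hd]
      simp only [map_mul, map_pow, eval_X, Matrix.cons_val_zero, Matrix.cons_val_one, map_ofNat, one_pow, one_mul]
      exact mul_ne_zero (four_ne_zero k h2) (pow_ne_zero 3 hζ0)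
  exact UniqueFactorizationMonoid.irreducible_iff_prime.mp hirr

/-- `T₀² + T₂²(T₁⁴ + 1) ∈ k[T₀,T₁,T₂]` is prime for `k = k̄`, `char k ≠ 2` (Eisenstein in `T₀` at
`(T₁, T₂) = (ζ, 1)`, `ζ⁴ = −1`). [folklore] -/
theorem prime_sq_add_sq_mul_pow_four_add_one [IsAlgClosed k] (h2 : (2 : k) ≠ 0) :
    Prime (X 0 ^ 2 + X 2 ^ 2 * (X 1 ^ 4 + 1) : MvPolynomial (Fin 3) k) := by
  obtain ⟨ζ, hζ⟩ := IsAlgClosed.exists_pow_nat_eq (-1 : k) (by norm_num : 0 < 4)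
  have hζ0 : ζ ≠ 0 := by rintro rfl; norm_num at hζ
  have hfin : finSuccEquiv k 2 (X 0 ^ 2 + X 2 ^ 2 * (X 1 ^ 4 + 1)) =
      Polynomial.X ^ 2 + Polynomial.C (X 1 ^ 2 * (X 0 ^ 4 + 1)) := by
    have h1 : finSuccEquiv k 2 (X 1) = Polynomial.C (X 0) := finSuccEquiv_X_succ (j := 0)
    have h2' : finSuccEquiv k 2 (X 2) = Polynomial.C (X 1) := finSuccEquiv_X_succ (j := 1)
    simp only [map_add, map_mul, map_pow, map_one, finSuccEquiv_X_zero, h1, h2']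
  have hirr : Irreducible (X 0 ^ 2 + X 2 ^ 2 * (X 1 ^ 4 + 1) : MvPolynomial (Fin 3) k) := by
    rw [← MulEquiv.irreducible_iff (finSuccEquiv k 2), hfin]
    refine irreducible_X_pow_add_C (by norm_num) _ ![ζ, 1] ?_ 0 ?_
    · simp only [map_add, map_mul, map_pow, map_one, eval_X, Matrix.cons_val_zero, Matrix.cons_val_one, hζ, one_pow]
      ring
    · have hd : (pderiv 0 : Derivation k (MvPolynomial (Fin 2) k) _) (X 1 ^ 2 * (X 0 ^ 4 + 1)) =
          X 1 ^ 2 * (4 * X 0 ^ 3) := by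
        simp [Derivation.leibniz, Derivation.leibniz_pow]
      rw [hd]
      simp only [map_mul, map_pow, eval_X, Matrix.cons_val_zero, Matrix.cons_val_one, map_ofNat, one_pow, one_mul]
      exact mul_ne_zero (four_ne_zero k h2) (pow_ne_zero 3 hζ0)
  exact UniqueFactorizationMonoid.irreducible_iff_prime.mp hirr

/-- **(C2), chart `X₁ ≠ 0`: `st₁ = frac₁₀² + exc₁²(1 + frac₁₂⁴)` is a prime element of `C₁`** (`k = k̄`,
`char k ≠ 2`), by transport of `prime_sq_add_sq_mul_one_add_pow_four` along `k[T] ≅ C₁`, `T₁ ↦ X₁`,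
`T_j ↦ X_j/X₁`. [OURS · SPECIMEN-Q vertex charts] -/
theorem prime_st₁ [IsAlgClosed k] (h2 : (2 : k) ≠ 0) :
    Prime (PointBlowup.frac 2 k 1 0 ^ 2 + PointBlowup.exc 2 k 1 ^ 2 * (1 + PointBlowup.frac 2 k 1 2 ^ 4)) := by
  obtain ⟨θ, hθ1, hθj⟩ := exists_ringEquiv_pointChart k 1
  have hθ : θ (X 0 ^ 2 + X 1 ^ 2 * (1 + X 2 ^ 4)) =
      PointBlowup.frac 2 k 1 0 ^ 2 + PointBlowup.exc 2 k 1 ^ 2 * (1 + PointBlowup.frac 2 k 1 2 ^ 4) := by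
    rw [map_add, map_pow, hθj 0 (by decide), map_mul, map_pow, hθ1, map_add, map_one, map_pow, hθj 2 (by decide)]
  rw [← hθ]
  exact (MulEquiv.prime_iff θ.toMulEquiv).mpr (prime_sq_add_sq_mul_one_add_pow_four k h2)

/-- **(C2), chart `X₂ ≠ 0`: `st₂ = frac₂₀² + exc₂²(frac₂₁⁴ + 1)` is prime in `C₂`** (`k = k̄`, `char k ≠ 2`). [OURS] -/
theorem prime_st₂ [IsAlgClosed k] (h2 : (2 : k) ≠ 0) :
    Prime (PointBlowup.frac 2 k 2 0 ^ 2 + PointBlowup.exc 2 k 2 ^ 2 * (PointBlowup.frac 2 k 2 1 ^ 4 + 1)) := by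
  obtain ⟨θ, hθ2, hθj⟩ := exists_ringEquiv_pointChart k 2
  have hθ : θ (X 0 ^ 2 + X 2 ^ 2 * (X 1 ^ 4 + 1)) =
      PointBlowup.frac 2 k 2 0 ^ 2 + PointBlowup.exc 2 k 2 ^ 2 * (PointBlowup.frac 2 k 2 1 ^ 4 + 1) := by
    rw [map_add, map_pow, hθj 0 (by decide), map_mul, map_pow, hθ2, map_add, map_one, map_pow, hθj 1 (by decide)]
  rw [← hθ]
  exact (MulEquiv.prime_iff θ.toMulEquiv).mpr (prime_sq_add_sq_mul_pow_four_add_one k h2)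

/-- **(C2), chart `X₁ ≠ 0`: `st₁ ∤ exc₁`** — `V(st₁) ⊄ V(exc₁)`: the point `(T₀,T₁,T₂) = (0, 1, ζ)`, `ζ⁴ = −1`,
is a zero of `T₀² + T₁²(1 + T₂⁴)` with `T₁ = 1 ≠ 0` (`k = k̄`). [OURS · SPECIMEN-Q vertex charts] -/
theorem not_st_dvd_exc₁ [IsAlgClosed k] :
    ¬ PointBlowup.frac 2 k 1 0 ^ 2 + PointBlowup.exc 2 k 1 ^ 2 * (1 + PointBlowup.frac 2 k 1 2 ^ 4) ∣
      PointBlowup.exc 2 k 1 := by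
  obtain ⟨ζ, hζ⟩ := IsAlgClosed.exists_pow_nat_eq (-1 : k) (by norm_num : 0 < 4)
  obtain ⟨θ, hθ1, hθj⟩ := exists_ringEquiv_pointChart k 1
  intro h
  have e0 : θ.symm (PointBlowup.frac 2 k 1 0) = X 0 := by rw [← hθj 0 (by decide), RingEquiv.symm_apply_apply]
  have e1 : θ.symm (PointBlowup.exc 2 k 1) = X 1 := by rw [← hθ1, RingEquiv.symm_apply_apply]
  have e2 : θ.symm (PointBlowup.frac 2 k 1 2) = X 2 := by rw [← hθj 2 (by decide), RingEquiv.symm_apply_apply]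
  have hs : θ.symm (PointBlowup.frac 2 k 1 0 ^ 2 + PointBlowup.exc 2 k 1 ^ 2 * (1 + PointBlowup.frac 2 k 1 2 ^ 4)) =
      X 0 ^ 2 + X 1 ^ 2 * (1 + X 2 ^ 4) := by
    simp only [map_add, map_mul, map_pow, map_one, e0, e1, e2]
  have h' := eval_symm_dvd_of_dvd k θ ![0, 1, ζ] h
  rw [hs, e1] at h'
  simp only [map_add, map_mul, map_pow, map_one, eval_X, Matrix.cons_val_zero, Matrix.cons_val_one,
    Matrix.cons_val_two, Matrix.tail_cons, Matrix.head_cons, hζ] at h'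
  norm_num at h'

/-- **(C2), chart `X₂ ≠ 0`: `st₂ ∤ exc₂`** — the zero `(T₀,T₁,T₂) = (0, ζ, 1)` of `T₀² + T₂²(T₁⁴ + 1)` has
`T₂ = 1 ≠ 0` (`k = k̄`). [OURS · SPECIMEN-Q vertex charts] -/
theorem not_st_dvd_exc₂ [IsAlgClosed k] :
    ¬ PointBlowup.frac 2 k 2 0 ^ 2 + PointBlowup.exc 2 k 2 ^ 2 * (PointBlowup.frac 2 k 2 1 ^ 4 + 1) ∣
      PointBlowup.exc 2 k 2 := by
  obtain ⟨ζ, hζ⟩ := IsAlgClosed.exists_pow_nat_eq (-1 : k) (by norm_num : 0 < 4)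
  obtain ⟨θ, hθ2, hθj⟩ := exists_ringEquiv_pointChart k 2
  intro h
  have e0 : θ.symm (PointBlowup.frac 2 k 2 0) = X 0 := by rw [← hθj 0 (by decide), RingEquiv.symm_apply_apply]
  have e1 : θ.symm (PointBlowup.frac 2 k 2 1) = X 1 := by rw [← hθj 1 (by decide), RingEquiv.symm_apply_apply]
  have e2 : θ.symm (PointBlowup.exc 2 k 2) = X 2 := by rw [← hθ2, RingEquiv.symm_apply_apply]
  have hs : θ.symm (PointBlowup.frac 2 k 2 0 ^ 2 + PointBlowup.exc 2 k 2 ^ 2 * (PointBlowup.frac 2 k 2 1 ^ 4 + 1)) =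
      X 0 ^ 2 + X 2 ^ 2 * (X 1 ^ 4 + 1) := by
    simp only [map_add, map_mul, map_pow, map_one, e0, e1, e2]
  have h' := eval_symm_dvd_of_dvd k θ ![0, ζ, 1] h
  rw [hs, e2] at h'
  simp only [map_add, map_mul, map_pow, map_one, eval_X, Matrix.cons_val_zero, Matrix.cons_val_one,
    Matrix.cons_val_two, Matrix.tail_cons, Matrix.head_cons, hζ] at h'
  norm_num at h'

/-- **Chart `X₀ ≠ 0`: `exc₀ ∤ st₀`** — `st₀ = 1 + exc₀²(…)` is `1` at the origin of `k[T] ≅ C₀`, where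
`exc₀ = T₀` vanishes (any field). [OURS · SPECIMEN-Q vertex charts] -/
theorem not_exc_dvd_st₀ :
    ¬ PointBlowup.exc 2 k 0 ∣
      1 + PointBlowup.exc 2 k 0 ^ 2 * (PointBlowup.frac 2 k 0 1 ^ 4 + PointBlowup.frac 2 k 0 2 ^ 4) := by
  obtain ⟨θ, hθ0, hθj⟩ := exists_ringEquiv_pointChart k 0
  intro h
  have e0 : θ.symm (PointBlowup.exc 2 k 0) = X 0 := by rw [← hθ0, RingEquiv.symm_apply_apply]
  have e1 : θ.symm (PointBlowup.frac 2 k 0 1) = X 1 := by rw [← hθj 1 (by decide), RingEquiv.symm_apply_apply]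
  have e2 : θ.symm (PointBlowup.frac 2 k 0 2) = X 2 := by rw [← hθj 2 (by decide), RingEquiv.symm_apply_apply]
  have hs : θ.symm (1 + PointBlowup.exc 2 k 0 ^ 2 * (PointBlowup.frac 2 k 0 1 ^ 4 + PointBlowup.frac 2 k 0 2 ^ 4)) =
      1 + X 0 ^ 2 * (X 1 ^ 4 + X 2 ^ 4) := by
    simp only [map_add, map_mul, map_pow, map_one, e0, e1, e2]
  have h' := eval_symm_dvd_of_dvd k θ ![0, 0, 0] h
  rw [hs, e0] at h'
  simp only [map_add, map_mul, map_pow, map_one, eval_X, Matrix.cons_val_zero, Matrix.cons_val_one,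
    Matrix.cons_val_two, Matrix.tail_cons, Matrix.head_cons] at h'
  norm_num at h'

/-- **Chart `X₁ ≠ 0`: `exc₁ ∤ st₁`** — at `(T₀,T₁,T₂) = (1, 0, 0)` the polynomial `T₀² + T₁²(1 + T₂⁴)` is `1`
while `exc₁ = T₁` vanishes (any field). [OURS · SPECIMEN-Q vertex charts] -/
theorem not_exc_dvd_st₁ :
    ¬ PointBlowup.exc 2 k 1 ∣
      PointBlowup.frac 2 k 1 0 ^ 2 + PointBlowup.exc 2 k 1 ^ 2 * (1 + PointBlowup.frac 2 k 1 2 ^ 4) := by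
  obtain ⟨θ, hθ1, hθj⟩ := exists_ringEquiv_pointChart k 1
  intro h
  have e0 : θ.symm (PointBlowup.frac 2 k 1 0) = X 0 := by rw [← hθj 0 (by decide), RingEquiv.symm_apply_apply]
  have e1 : θ.symm (PointBlowup.exc 2 k 1) = X 1 := by rw [← hθ1, RingEquiv.symm_apply_apply]
  have e2 : θ.symm (PointBlowup.frac 2 k 1 2) = X 2 := by rw [← hθj 2 (by decide), RingEquiv.symm_apply_apply]
  have hs : θ.symm (PointBlowup.frac 2 k 1 0 ^ 2 + PointBlowup.exc 2 k 1 ^ 2 * (1 + PointBlowup.frac 2 k 1 2 ^ 4)) =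
      X 0 ^ 2 + X 1 ^ 2 * (1 + X 2 ^ 4) := by
    simp only [map_add, map_mul, map_pow, map_one, e0, e1, e2]
  have h' := eval_symm_dvd_of_dvd k θ ![1, 0, 0] h
  rw [hs, e1] at h'
  simp only [map_add, map_mul, map_pow, map_one, eval_X, Matrix.cons_val_zero, Matrix.cons_val_one,
    Matrix.cons_val_two, Matrix.tail_cons, Matrix.head_cons] at h'
  norm_num at h'

/-- **Chart `X₂ ≠ 0`: `exc₂ ∤ st₂`** — at `(T₀,T₁,T₂) = (1, 0, 0)` the polynomial `T₀² + T₂²(T₁⁴ + 1)` is `1`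
while `exc₂ = T₂` vanishes (any field). [OURS · SPECIMEN-Q vertex charts] -/
theorem not_exc_dvd_st₂ :
    ¬ PointBlowup.exc 2 k 2 ∣
      PointBlowup.frac 2 k 2 0 ^ 2 + PointBlowup.exc 2 k 2 ^ 2 * (PointBlowup.frac 2 k 2 1 ^ 4 + 1) := by
  obtain ⟨θ, hθ2, hθj⟩ := exists_ringEquiv_pointChart k 2
  intro h
  have e0 : θ.symm (PointBlowup.frac 2 k 2 0) = X 0 := by rw [← hθj 0 (by decide), RingEquiv.symm_apply_apply]
  have e1 : θ.symm (PointBlowup.frac 2 k 2 1) = X 1 := by rw [← hθj 1 (by decide), RingEquiv.symm_apply_apply]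
  have e2 : θ.symm (PointBlowup.exc 2 k 2) = X 2 := by rw [← hθ2, RingEquiv.symm_apply_apply]
  have hs : θ.symm (PointBlowup.frac 2 k 2 0 ^ 2 + PointBlowup.exc 2 k 2 ^ 2 * (PointBlowup.frac 2 k 2 1 ^ 4 + 1)) =
      X 0 ^ 2 + X 2 ^ 2 * (X 1 ^ 4 + 1) := by
    simp only [map_add, map_mul, map_pow, map_one, e0, e1, e2]
  have h' := eval_symm_dvd_of_dvd k θ ![1, 0, 0] h
  rw [hs, e2] at h'
  simp only [map_add, map_mul, map_pow, map_one, eval_X, Matrix.cons_val_zero, Matrix.cons_val_one,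
    Matrix.cons_val_two, Matrix.tail_cons, Matrix.head_cons] at h'
  norm_num at h'

/-! ## (C3) `√(excᵢ, stᵢ) = (excᵢ, fracᵢ₀)` with regular quotient `≅ k[T]` (`i = 1, 2`) -/
/-- **Chart `X₁ ≠ 0`: `(exc₁, frac₁₀)` is a prime ideal of `C₁`** (the image of `(T₁, T₀)` under `k[T] ≅ C₁`).
[OURS · SPECIMEN-Q vertex charts] -/
theorem isPrime_span_exc_frac₁ :
    (Ideal.span {PointBlowup.exc 2 k 1, PointBlowup.frac 2 k 1 0}).IsPrime := by
  obtain ⟨θ, hθ1, hθj⟩ := exists_ringEquiv_pointChart k 1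
  exact (isPrime_and_isRegularRing_of_image_X k θ {1, 0}
    (by rw [Set.image_pair, Set.image_pair, hθ1, hθj 0 (by decide)])).1

/-- **Chart `X₁ ≠ 0`: `C₁/(exc₁, frac₁₀) ≅ k[T₂]` is a regular ring** — so `V(Z)_red ∩ chart₁` is regular,
`Sing = ∅`. [OURS · SPECIMEN-Q vertex charts] -/
theorem isRegularRing_quotient_span_exc_frac₁ :
    IsRegularRing (PointBlowup.Chart 2 k 1 ⧸ Ideal.span {PointBlowup.exc 2 k 1, PointBlowup.frac 2 k 1 0}) := by
  obtain ⟨θ, hθ1, hθj⟩ := exists_ringEquiv_pointChart k 1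
  exact (isPrime_and_isRegularRing_of_image_X k θ {1, 0}
    (by rw [Set.image_pair, Set.image_pair, hθ1, hθj 0 (by decide)])).2

/-- **(C3), chart `X₁ ≠ 0`: `√(exc₁, st₁) = (exc₁, frac₁₀)`** (`st₁ ≡ frac₁₀²` modulo `exc₁`, and
`(exc₁, frac₁₀)` is prime). [OURS · SPECIMEN-Q vertex charts] -/
theorem radical_span_exc_st₁ :
    (Ideal.span {PointBlowup.exc 2 k 1,
        PointBlowup.frac 2 k 1 0 ^ 2 + PointBlowup.exc 2 k 1 ^ 2 * (1 + PointBlowup.frac 2 k 1 2 ^ 4)}).radical =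
      Ideal.span {PointBlowup.exc 2 k 1, PointBlowup.frac 2 k 1 0} := by
  apply le_antisymm
  · rw [(isPrime_span_exc_frac₁ k).radical_le_iff, Ideal.span_le, Set.insert_subset_iff, Set.singleton_subset_iff,
      SetLike.mem_coe, SetLike.mem_coe]
    refine ⟨Ideal.subset_span (Set.mem_insert _ _), Ideal.mem_span_pair.mpr ?_⟩
    exact ⟨PointBlowup.exc 2 k 1 * (1 + PointBlowup.frac 2 k 1 2 ^ 4), PointBlowup.frac 2 k 1 0, by ring⟩
  · rw [Ideal.span_le, Set.insert_subset_iff, Set.singleton_subset_iff, SetLike.mem_coe, SetLike.mem_coe]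
    refine ⟨Ideal.le_radical (Ideal.subset_span (Set.mem_insert _ _)), Ideal.mem_radical_iff.mpr ⟨2, ?_⟩⟩
    exact Ideal.mem_span_pair.mpr
      ⟨-(PointBlowup.exc 2 k 1 * (1 + PointBlowup.frac 2 k 1 2 ^ 4)), 1, by ring⟩

/-- **Chart `X₂ ≠ 0`: `(exc₂, frac₂₀)` is a prime ideal of `C₂`.** [OURS · SPECIMEN-Q vertex charts] -/
theorem isPrime_span_exc_frac₂ :
    (Ideal.span {PointBlowup.exc 2 k 2, PointBlowup.frac 2 k 2 0}).IsPrime := by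
  obtain ⟨θ, hθ2, hθj⟩ := exists_ringEquiv_pointChart k 2
  exact (isPrime_and_isRegularRing_of_image_X k θ {2, 0}
    (by rw [Set.image_pair, Set.image_pair, hθ2, hθj 0 (by decide)])).1

/-- **Chart `X₂ ≠ 0`: `C₂/(exc₂, frac₂₀) ≅ k[T₁]` is a regular ring.** [OURS · SPECIMEN-Q vertex charts] -/
theorem isRegularRing_quotient_span_exc_frac₂ :
    IsRegularRing (PointBlowup.Chart 2 k 2 ⧸ Ideal.span {PointBlowup.exc 2 k 2, PointBlowup.frac 2 k 2 0}) := by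
  obtain ⟨θ, hθ2, hθj⟩ := exists_ringEquiv_pointChart k 2
  exact (isPrime_and_isRegularRing_of_image_X k θ {2, 0}
    (by rw [Set.image_pair, Set.image_pair, hθ2, hθj 0 (by decide)])).2

/-- **(C3), chart `X₂ ≠ 0`: `√(exc₂, st₂) = (exc₂, frac₂₀)`.** [OURS · SPECIMEN-Q vertex charts] -/
theorem radical_span_exc_st₂ :
    (Ideal.span {PointBlowup.exc 2 k 2,
        PointBlowup.frac 2 k 2 0 ^ 2 + PointBlowup.exc 2 k 2 ^ 2 * (PointBlowup.frac 2 k 2 1 ^ 4 + 1)}).radical =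
      Ideal.span {PointBlowup.exc 2 k 2, PointBlowup.frac 2 k 2 0} := by
  apply le_antisymm
  · rw [(isPrime_span_exc_frac₂ k).radical_le_iff, Ideal.span_le, Set.insert_subset_iff, Set.singleton_subset_iff,
      SetLike.mem_coe, SetLike.mem_coe]
    refine ⟨Ideal.subset_span (Set.mem_insert _ _), Ideal.mem_span_pair.mpr ?_⟩
    exact ⟨PointBlowup.exc 2 k 2 * (PointBlowup.frac 2 k 2 1 ^ 4 + 1), PointBlowup.frac 2 k 2 0, by ring⟩
  · rw [Ideal.span_le, Set.insert_subset_iff, Set.singleton_subset_iff, SetLike.mem_coe, SetLike.mem_coe]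
    refine ⟨Ideal.le_radical (Ideal.subset_span (Set.mem_insert _ _)), Ideal.mem_radical_iff.mpr ⟨2, ?_⟩⟩
    exact Ideal.mem_span_pair.mpr
      ⟨-(PointBlowup.exc 2 k 2 * (PointBlowup.frac 2 k 2 1 ^ 4 + 1)), 1, by ring⟩

/-! ## (C4) Chart `X₀ ≠ 0`: the strict transform misses the exceptional divisor -/
/-- **(C4): `(exc₀, st₀) = (1)`** — `st₀ = 1 + exc₀²(frac₀₁⁴ + frac₀₂⁴) ≡ 1` modulo `exc₀`: on the chart
`X₀ ≠ 0` the strict transform does not meet `e = V(exc₀)`. [OURS · SPECIMEN-Q vertex charts] -/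
theorem span_exc_st₀_eq_top :
    Ideal.span {PointBlowup.exc 2 k 0,
        1 + PointBlowup.exc 2 k 0 ^ 2 * (PointBlowup.frac 2 k 0 1 ^ 4 + PointBlowup.frac 2 k 0 2 ^ 4)} = ⊤ := by
  rw [Ideal.eq_top_iff_one, Ideal.mem_span_pair]
  exact ⟨-(PointBlowup.exc 2 k 0 * (PointBlowup.frac 2 k 0 1 ^ 4 + PointBlowup.frac 2 k 0 2 ^ 4)), 1, by ring⟩

/-- **Chart `X₀ ≠ 0`: `(exc₀, frac₀₁, frac₀₂)` is a prime ideal of `C₀`** (the image of `(T₀, T₁, T₂)`; its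
quotient is `k`) — a point of `e` which, by `span_exc_st₀_eq_top`, is not on the strict transform.
[OURS · SPECIMEN-Q vertex charts] -/
theorem isPrime_span_exc_frac_frac₀ :
    (Ideal.span {PointBlowup.exc 2 k 0, PointBlowup.frac 2 k 0 1, PointBlowup.frac 2 k 0 2}).IsPrime := by
  obtain ⟨θ, hθ0, hθj⟩ := exists_ringEquiv_pointChart k 0
  exact (isPrime_and_isRegularRing_of_image_X k θ {0, 1, 2}
    (by rw [Set.image_insert_eq, Set.image_insert_eq, Set.image_pair, Set.image_pair, hθ0, hθj 1 (by decide),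
      hθj 2 (by decide)])).1

/-- `st₀` does not lie in the prime `(exc₀, frac₀₁, frac₀₂)`: the point of `e ∖ St H` on the chart `X₀ ≠ 0`.
[OURS · SPECIMEN-Q vertex charts] -/
theorem st_not_mem_span_exc_frac_frac₀ :
    1 + PointBlowup.exc 2 k 0 ^ 2 * (PointBlowup.frac 2 k 0 1 ^ 4 + PointBlowup.frac 2 k 0 2 ^ 4) ∉
      Ideal.span {PointBlowup.exc 2 k 0, PointBlowup.frac 2 k 0 1, PointBlowup.frac 2 k 0 2} := by
  intro h
  apply (isPrime_span_exc_frac_frac₀ k).ne_top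
  rw [eq_top_iff, ← span_exc_st₀_eq_top k, Ideal.span_le, Set.insert_subset_iff, Set.singleton_subset_iff]
  exact ⟨Ideal.subset_span (Set.mem_insert _ _), h⟩

/-! ## The strict transform at ring level: the `excᵢ`-saturation of `fN · Cᵢ` is `(stᵢ)` -/
/-- **Chart `X₀ ≠ 0`:** the kernel of `C₀ = A[𝔪/X₀] → (A/fN)[𝔪̄/X̄₀]` (the chart ring of `Bl_v H`) is `(st₀)`:
`St H ∩ chart₀ = V(st₀)` as the `exc₀`-saturation of `fN · C₀`. [OURS · SPECIMEN-Q vertex charts; GW 13.96 (2)] -/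
theorem ker_mapQuotient_fSing'_chart₀ :
    RingHom.ker (blowupAlgebra.mapQuotient (PointBlowup.originIdeal 2 k) (X 0 : MvPolynomial (Fin 3) k)
        (Ideal.span {fSing' k})) =
      Ideal.span {1 + PointBlowup.exc 2 k 0 ^ 2 * (PointBlowup.frac 2 k 0 1 ^ 4 + PointBlowup.frac 2 k 0 2 ^ 4)} :=
  blowupAlgebra.ker_mapQuotient_eq_span _ _ (algebraMap_fSing'_chart₀ k) (prime_exc k 0) (not_exc_dvd_st₀ k)

/-- **Chart `X₁ ≠ 0`:** the kernel of `C₁ → (A/fN)[𝔪̄/X̄₁]` is `(st₁)`. [OURS · SPECIMEN-Q vertex charts; GW 13.96 (2)] -/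
theorem ker_mapQuotient_fSing'_chart₁ :
    RingHom.ker (blowupAlgebra.mapQuotient (PointBlowup.originIdeal 2 k) (X 1 : MvPolynomial (Fin 3) k)
        (Ideal.span {fSing' k})) =
      Ideal.span {PointBlowup.frac 2 k 1 0 ^ 2 + PointBlowup.exc 2 k 1 ^ 2 * (1 + PointBlowup.frac 2 k 1 2 ^ 4)} :=
  blowupAlgebra.ker_mapQuotient_eq_span _ _ (algebraMap_fSing'_chart₁ k) (prime_exc k 1) (not_exc_dvd_st₁ k)

/-- **Chart `X₂ ≠ 0`:** the kernel of `C₂ → (A/fN)[𝔪̄/X̄₂]` is `(st₂)`. [OURS · SPECIMEN-Q vertex charts; GW 13.96 (2)] -/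
theorem ker_mapQuotient_fSing'_chart₂ :
    RingHom.ker (blowupAlgebra.mapQuotient (PointBlowup.originIdeal 2 k) (X 2 : MvPolynomial (Fin 3) k)
        (Ideal.span {fSing' k})) =
      Ideal.span {PointBlowup.frac 2 k 2 0 ^ 2 + PointBlowup.exc 2 k 2 ^ 2 * (PointBlowup.frac 2 k 2 1 ^ 4 + 1)} :=
  blowupAlgebra.ker_mapQuotient_eq_span _ _ (algebraMap_fSing'_chart₂ k) (prime_exc k 2) (not_exc_dvd_st₂ k)

end Summit.ResolutionOfSingularities.ResolutionOfSingularities.Theorems.EquisingularLift.SpecimenQuartic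

end
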